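import Summits.ResolutionOfSingularities.ResolutionOfSingularities.Theorems.FrobeniusClosingSteerWords14ThreadSplit
import Literature.AlgebraicGeometry.Resolution.LipmanValuativeQuadraticSequence
import Summits.ResolutionOfSingularities.ResolutionOfSingularities.Theorems.FrobeniusClosingSteerHitHeight
import Summits.ResolutionOfSingularities.ResolutionOfSingularities.Theorems.FrobeniusClosingSteerLowShapeDuals
import Summits.ResolutionOfSingularities.ResolutionOfSingularities.Theorems.FrobeniusClosingSteerMemberDualDerivations
import Summits.ResolutionOfSingularities.ResolutionOfSingularities.Theorems.FrobeniusClosingSteerLowSurfaceStepExits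
import Summits.ResolutionOfSingularities.ResolutionOfSingularities.Theorems.FrobeniusClosingSteerLowTaming
import Summits.ResolutionOfSingularities.ResolutionOfSingularities.Theorems.FrobeniusClosingSteerLowTowerPointSteps
import Summits.ResolutionOfSingularities.ResolutionOfSingularities.Theorems.FrobeniusClosingSteerLowTowerSingular
import Summits.ResolutionOfSingularities.ResolutionOfSingularities.Theorems.FrobeniusClosingSteerThreadFinitelyHit
import Summits.ResolutionOfSingularities.ResolutionOfSingularities.Theorems.FrobeniusClosingSteerThreadWander
import Summits.ResolutionOfSingularities.ResolutionOfSingularities.Theorems.FrobeniusClosingSteerTowerHeight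

/-!
# Crux `Steer` (stmt-ResolutionOfSingularities-16345), line `switching-dichotomy` — WORDS 15: §σ2.23 LOW CLOSES MODULO LIPMAN — the typed LOW assembly of the p = 2 σ_top-STEERED COMPOSITION (res-L0-w41-strat-2; plan-1 RULINGS 18c/19d/20d/21b) (HOIST of the registered skeleton r38 cc5f2c8f0939be83, l.2015–2225, inside `section SteeredTwo`)

Holder res-L0-w41-lead-1 g5 on res-L0-w41-plan-1 RULING 47 (E1) / 104b; see `…Words01Core` for the hoist protocol (bodies byte for byte;
`[cite: …]` / `[folklore]` tags on CLOSED `def … : Prop` words are written «(ref. …)» / «(folklore)» — GATE NOTE of `…Words02Stubs`;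
cite keys inside `[cite:]` tags normalised to `references.bib` keys where needed, as in `…Words03Phases`).
Nothing here is a statement of the manuscript [claim: Hironaka2017, status: under-review]. OURS (candidates / vocabulary; AI review is
weaker than expert review).
-/

open Summit.ResolutionOfSingularities.ResolutionOfSingularities.Theses.FrobeniusClosing (IsolatedForcedTermination)
open Literature.AlgebraicGeometry.Resolution (IsAbhyankarPlace FGOver exists_ringKrullDim_eq_and_trdeg_eq
  trdeg_eq_trdeg_of_isFractionRing locAtCentre IsQuadraticTransformAlong SubringDominates IsRsopPart
  LocalUniformization3 RelLocalUniformization CossartPiltant2019General)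
open Summit.ResolutionOfSingularities.ResolutionOfSingularities.Theorems.SteerRankThinness
  (HasProperCoarsening concl_of_hasProperCoarsening rankOne_of_not_hasProperCoarsening)
open Summit.ResolutionOfSingularities.ResolutionOfSingularities.Theorems.PfaffLine

set_option linter.dupNamespace false

namespace Summit.ResolutionOfSingularities.ResolutionOfSingularities.Theorems.SwitchingDichotomy.Words

section SteeredTwo

open IsLocalRing
open Literature.AlgebraicGeometry.Resolution (IsLocalBlowupAlong IsQuadraticTransform IsExcellentRing)

variable {K : Type} [Field K]


/-! ### §σ2.23 (res-L0-w41-strat-2; plan-1 RULINGS 18c / 19d(c) / 20d / 21b) — LOW CLOSES MODULO LIPMAN: the typed LOW assembly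
(source: res-L0-w41-idea-3 card 3 v3 c62dcfebeca5954d + Sketch v3 002c191ce4e71718 §5 — §5.5 definitions VERBATIM; `NoEternalTamedMixedBranch` =
res-type-026's k-frame ASK 08:36:37Z VERBATIM (RULING 21b(i)); OURS, candidates behind the Props, not facts; AI review weaker than expert review).
READING (idea-3 F0–F6; res-D-pv-012 D3a SCOPE 08:52:21Z): along an eventually-LOW 2-steered run every member lies in `Λ = (R 0)_{P₀}`
(`P₀ = (D₁f, D₂f)` the critical-surface prime, C2; FOLLOWED: C5 = lead-1 `CriticalSurface.criticalSurfaceFollowed` p514735), the residue map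
`φ : Λ → κ = κ(P₀)` carries the run to the CRITICAL-SURFACE TOWER `A_n = φ(R_n) ⊆ κ`, `h_n = φ(s_n²)`, `Y_n = A_n[T_n] ⊆ L′ = κ(√h̄₀)` (one field,
`trdeg_k L′ = 2`), and `Y` is a TAMED MIXED BRANCH — point step ↦ quadratic transform, curve step ↦ proper partial normalisation, surface step
impossible (C8), infinitely many point steps (F1 = D3b), point steps eventually at NORMAL members (F5 = D3c), every member SINGULAR (D3d) — to
which Lipman 1978 along a valuation (tree fact `Lipman1978ValuativeQuadraticSequence`, PROVED ⇐ `Lipman1978SequenceFinite`) gives a regular member.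
PIECES (RULING 9 shape): `MembersDualDerivationsTwoN` (S–M; hand: plan-1 to name) · C8 `LowSurfaceStepExitsTwo` (S; res-type-072 g13 — PROPOSED
CUT, 072's posted statement governs per RULING 21b(iii) and replaces this text verbatim if it differs; nothing below consumes C8 yet) · D3b
`LowPointStepsIOTwoN` (M; run-level form of F1 — res-D-pv-007's `curveStep_derivation`/`cleaningBudget` + a run wrapper) · D3
`LowRunTamedMixedBranchTwo` (L; = D3a tower + moves (res-D-pv-012, pieces M1–M5 over `Λ, φ, κ, L′`) ∘ D3b ∘ D3c taming (res-type-062) ∘ D3d all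
members singular (res-L0-w41-stub-3): D3a/D3c/D3d are statements about pv-012's CONCRETE tower and are typed in §σ2.24 as Props over pv-012's
posted M1–M5 vocabulary together with the glue `lowRunTamedMixedBranchTwo_of_pieces : MembersDualDerivationsTwoN → RankFourExitTwo →
LowSurfaceStepExitsTwo → LowPointStepsIOTwoN → <D3a> → <D3c> → <D3d> → LowRunTamedMixedBranchTwo` — B7/C8/derivations are consumed THERE, not by
the kernel, so no binder is decoration) · `NoEternalTamedMixedBranch` (M; res-type-026 ⇐ `Lipman1978ValuativeQuadraticSequence.{0}`) · pv-028's
one-step `step` (§σ2.19 shape). KERNEL (proved here): `lowOrderTailConclTwoN_of_tamedBranch (step) (hD3) (hNE) : LowOrderTailConclTwoN` and, in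
r27's `hLow`-slot shape, `lowOrderTailConclTwoN_of_lipman (step) (hD3) (hRed) : Lipman1978ValuativeQuadraticSequence.{0} → LowOrderTailConclTwoN`;
the slate instance `eternalSteeredRunTwo_of_slate_low` follows `eternalSteeredRunTwo_of_slate` below. LOW then carries NO frontier name. -/

/-- OURS (idea-3 C2 input, strat-2 wording): the local ring `R ⊆ K` carries a COORDINATE SYSTEM WITH DUAL DERIVATIONS — `y : Fin 4 → R`
generating `𝔪_R` and derivations `D a` (over `ℤ`; with a perfect ground field every derivation is `k`-linear) with `D a (y b) = δ_{ab}`. True for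
the run's members (essentially of finite type and regular over the perfect `k` at a closed point with residue field finite separable over `k`:
the conormal sequence makes `dy₁ … dy₄` a basis of the free module `Ω_{R/k}`); any other regular system of parameters then has dual derivations
too (base change by the unit Jacobian matrix). [cite: Matsumura1987, Thms. 25.2, 30.6] -/
def HasDualDerivations (R : Subring K) : Prop :=
  ∃ (_ : IsLocalRing R) (y : Fin 4 → R) (D : Fin 4 → Derivation ℤ R R),
    Ideal.span (Set.range y) = IsLocalRing.maximalIdeal R ∧ ∀ a b, D a (y b) = if a = b then 1 else 0

/-- **MembersDualDerivationsTwoN** (S–M; hand to be named by plan-1 — Kähler differentials, or the in-tree Kunz `p`-basis route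
`exists_basis_frobeniusPower_monomials` / J3 dual-`p`-basis p511731 (res-D-pv-004), or pv-007's `exists_derivation_apply_ne_zero` kit): every
member of a steered run from the core datum has a coordinate system with dual derivations. Members are `locAtCentre` of finitely generated
`k`-algebras at CLOSED points (`ZeroDim` row), regular (M p501181) of dimension 4 (K-T1 p503921), `k` perfect. Why it might fail: bookkeeping only
(essential finite type is preserved by local blow-ups; residue field finite separable over the perfect `k`). OURS. (ref. Matsumura1987, Thm. 30.6) -/
def MembersDualDerivationsTwoN : Prop :=
  ∀ p : ℕ, p = 2 →
    ∀ (k K : Type) [Field k] [CharP k p] [PerfectField k] [Field K] [Algebra k K]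
    (O : ValuationSubring K) (A₀ : Subalgebra k K) (h₀ : A₀.toSubring ≤ O.toSubring) (t : K),
    CoreDatum p 4 k K O A₀ h₀ t →
    ∀ (R : ℕ → Subring K) (P : (i : ℕ) → Ideal (R i)) (s : ℕ → K),
      R 0 = locAtCentre A₀.toSubring O → IsSteeredRun O R P t p s → ∀ j, HasDualDerivations (R j)

/-- **C8 · LowSurfaceStepExitsTwo — PROPOSED CUT** (S; res-type-072 g13; RULING 21b(iii): 072's posted statement governs and replaces this
text if it differs; idea-3 card 3 v3 F0/MOVES + C3 remark): at a stage of a 2-steered run presented in POLAR-RANK-≤-2 form `f = g² + z·w + c`,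
`z, w ∈ 𝔪`, `c ∈ 𝔪³` (B7 `RankFourExitTwo`'s output) which is NOT high-order (so `z̄, w̄` are linearly independent in `𝔪/𝔪²`: low shape),
with dual derivations available, a POSITIVE-dimensional σ_top centre is a CURVE (height 3). Sketch: extend `(w, z)` to a regular system
`(l₁, l₂, l₃, l₄)`, take `D₁, D₂` dual; C1 `jacobian_mem_of_singular` + C2 `criticalSurface` (p511593): every singular prime contains
`e₁ = D₁ f, e₂ = D₂ f` and a prime `∋ e₁, e₂` of height `≤ 2` equals `P₀ = (e₁, e₂)` — so no singular DIVISOR, and a singular SURFACE centre is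
`P₀`; blowing up `P₀` (exceptional parameter `x`, `P₀ R′ = x R′`, `e₁ = x a`, `e₂ = x b` with `a` or `b` a unit) the transported derivation
`x·Dⱼ` sends `f′ = (f − γ²)/x²` to `eⱼ/x`, a UNIT — so `f′` is not a square modulo `𝔪′²`, the torsor at stage `i + 1` is regular at the closed
point and σ_top has no centre there, contradicting the run at `i + 1`. Why it might fail: the exceptional-parameter bookkeeping `P₀ R′ = x R′`
for a surface centre (tree `IsLocalBlowupAlong`). OURS. (folklore) -/
def LowSurfaceStepExitsTwo : Prop :=
  ∀ {K : Type} [Field K] [CharP K 2] (O : ValuationSubring K) (R : ℕ → Subring K) (P : (i : ℕ) → Ideal (R i))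
    (t : K) (s : ℕ → K) (_hrun : IsSteeredRun O R P t 2 s) (i : ℕ)
    (_hR : ∀ j, ∃ B : Subring K, B ≤ O.toSubring ∧ R j = locAtCentre B O)
    (_hreg : IsRegularLocalRing (R i)) (_hreg' : IsRegularLocalRing (R (i + 1)))
    (_hdim : ringKrullDim (R i) = 4) (_hdim' : ringKrullDim (R (i + 1)) = 4)
    (_hperf : ∀ j, ∀ (_ : IsLocalRing (R j)) (a : R j), ∃ b : R j, a - b ^ 2 ∈ maximalIdeal (R j))
    (_hirr : ∀ j, ∀ y z : R j, (z : K) ≠ 0 → s j * z ≠ y)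
    (_hder : HasDualDerivations (R i))
    (hs : s i ^ 2 ∈ R i) (g z w : R i) (_hz : z ∈ maximalIdeal (R i)) (_hw : w ∈ maximalIdeal (R i))
    (_hf : (⟨s i ^ 2, hs⟩ : R i) - g ^ 2 - z * w ∈ maximalIdeal (R i) ^ 3)
    (_hlow : ¬ IsHighOrderAt R s 2 i) (_hpos : ¬ IsPointStep R P i), (P i).height = 3

/-- LEAF (res-type-072 g13): strat-2's PART A words of record, closed from the landed p517667 (`lowSurfaceStep_height_eq_three`) via the
(A1′) normalisation p519634 (`exists_lowShape_duals`). OURS. [folklore] -/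
theorem lowSurfaceStepExitsTwo_holds : LowSurfaceStepExitsTwo := by
  intro K _ _ O R P t s hrun i hR hreg hreg' hdim hdim' hperf hirr hder hs g z w hz hw hf hlow hpos
  obtain ⟨hloc, hs₀, hσ, hbl, hstrict⟩ := hrun.2 i
  obtain ⟨hloc', hs', hσ', -, -⟩ := hrun.2 (i + 1)
  have hP : P i ≠ maximalIdeal (R i) := fun h => hpos ⟨hloc, h⟩
  obtain ⟨_, y, D, hy, hD⟩ := hder
  have hlow' : ∀ g' : R i, (⟨s i ^ 2, hs⟩ : R i) - g' ^ 2 ∉ maximalIdeal (R i) ^ 3 :=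
    fun g' h => hlow ⟨hloc, hs, g', h⟩
  obtain ⟨l₃, l₄, c, D₁, D₂, hfc, hc, hspan, h11, h12, h21, h22⟩ :=
    _root_.Summit.ResolutionOfSingularities.ResolutionOfSingularities.Theorems.SwitchingDichotomy.CriticalSurface.exists_lowShape_duals
      (hperf i hloc) y D hy hD _ g z w hz hw hf hlow'
  exact _root_.Summit.ResolutionOfSingularities.ResolutionOfSingularities.Theorems.SwitchingDichotomy.CriticalSurface.lowSurfaceStep_height_eq_three
    O (R i) (R (i + 1)) hdim (s i) (s (i + 1)) hs hs'
    g z w l₃ l₄ c hfc hc hspan D₁ D₂ h11 h12 h21 h22 (P i) hσ hP hbl hstrict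
    (_root_.Summit.ResolutionOfSingularities.ResolutionOfSingularities.Theorems.SwitchingDichotomy.CriticalSurface.exists_cleaning_of_sigmaTop
      (R (i + 1)) ⟨s (i + 1) ^ 2, hs'⟩ (P (i + 1)) hσ')

/-- (idea-3 Sketch v3 §5.5 VERBATIM.) `z ∈ K` is INTEGRAL OVER the subring `Q ⊆ K`: a root of a monic polynomial with coefficients in
`Q` (coefficientwise, instance-free). OURS wording. [folklore] -/
def IsIntegralOver (Q : Subring K) (z : K) : Prop :=
  ∃ q : Polynomial K, q.Monic ∧ (∀ i, q.coeff i ∈ Q) ∧ q.eval z = 0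

/-- (idea-3 Sketch v3 §5.5 VERBATIM.) `S ⊆ K` is INTEGRALLY CLOSED IN `K` (= normal, when `K` is its field of fractions). OURS wording.
[folklore] -/
def IsNormalIn (S : Subring K) : Prop :=
  ∀ z : K, IsIntegralOver S z → z ∈ S

/-- (idea-3 Sketch v3 §5.5 VERBATIM.) A PROPER PARTIAL NORMALISATION step: `S < S'`, `S'` local, `S'` integral over `S` (hence birational).
In the LOW surface game this is a σ_top CURVE step read on `Σ₂`: `Y = A[T]/(T² − h) ⊂ Y' = A[T'] /(T'² − (h − ḡ²)/w̄²)`, `T = w̄ T' + ḡ`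
(idea-3 C3/§5.3; pv-012 M2/M4), proper because the centre curve is singular for the torsor (res-type-082
`RadicandSingular.not_isRegularLocalRing_adjoinRoot_atPrime_iff` at the height-one prime). OURS. [folklore] -/
def IsPartialNormalisation (S S' : Subring K) : Prop :=
  S ≤ S' ∧ S ≠ S' ∧ IsLocalRing S' ∧ ∀ z ∈ S', IsIntegralOver S z

/-- (idea-3 Sketch v3 §5.5 VERBATIM, RULING 21b(i).) A TAMED MIXED BRANCH: every step is a quadratic transform («point step») or a proper
partial normalisation («curve step»); infinitely many point steps (F1); from some stage on every point step is taken at a NORMAL member (F5).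
OURS. [folklore] -/
def IsTamedMixedBranch (Y : ℕ → Subring K) : Prop :=
  (∀ n, IsQuadraticTransform (Y n) (Y (n + 1)) ∨ IsPartialNormalisation (Y n) (Y (n + 1))) ∧
  (∀ n₀, ∃ n, n₀ ≤ n ∧ IsQuadraticTransform (Y n) (Y (n + 1))) ∧
  (∃ n₀, ∀ n, n₀ ≤ n → IsQuadraticTransform (Y n) (Y (n + 1)) → IsNormalIn (Y n))

/-- **D3 · LowRunTamedMixedBranchTwo** (L; RULING 21b(iv) shape; = D3a ∘ D3b ∘ D3c ∘ D3d, hands res-D-pv-012 / res-D-pv-007 / res-type-062 /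
res-L0-w41-stub-3; assembling glue `lowRunTamedMixedBranchTwo_of_pieces` = §σ2.24 over pv-012's M1–M5 vocabulary): along a normalised 2-steered
run from the core datum that is LOW from some stage on there are a field `L′` of transcendence degree 2 over the ORIGINAL perfect `k` and a
sequence `Y : ℕ → Subalgebra k L′` of LOCAL members, essentially of finite type over `k`, with fraction field `L′`, forming a tamed mixed branch,
NONE of them regular. Dictionary (idea-3 / pv-012 D3a SCOPE): `Λ = (R 0)_{P₀} ⊇ R_n` for all `n` (C5 followed), `φ : Λ → κ = κ(P₀)`,
`A_n = φ(R_n)`, `h_n = φ(s_n²)`, `L′ = κ(√h̄₀)` (a field: `h̄ₙ` is never a square in `κ`, else `Σ₂ ⊆ Sing` and the surface step exits, C8;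
TIP: extend `φ` to `Λ[s₀] ∋ s_n` — the `x_n` are `Λ`-units — so `Y_n = φ̃(R_n[s_n])` and `T_n = φ̃(s_n)`, M4's recursion being M3), point step ↦
`IsQuadraticTransform` (M1, C9 `pointStep_derivation`, res-type-026's realisation layer), curve step ↦ `IsPartialNormalisation` (M2: `A`
unchanged; proper by res-type-082's criterion), surface step excluded (C8), polar rank four excluded (B7); F1 (D3b) ⇒ clause (2); F5 (D3c: δ-drop
`IsBlowup.finsum_pointDelta_strictTransform_lt`, C3 `lowStageDichotomy`, 082 `isPermissibleCentre_two_iff`) ⇒ clause (3); D3d (C7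
`singAlongCriticalSurface` p513150 at `𝔪`) ⇒ every `Y_n` singular. The no-dominant-tail hypothesis is NOT used. Why it might fail: (F5)(i) «curve
steps create no bad curves» is hand-derived only (tri-3 R-H audit); `trdeg_k L′ = 2 = dim A_n` and `EssFiniteType` bookkeeping (Mathlib
coverage). OURS. (ref. Lipman1978, (1.32)–(1.33) p. 174) -/
def LowRunTamedMixedBranchTwo : Prop :=
  ∀ p : ℕ, p = 2 →
    ∀ (k K : Type) [Field k] [CharP k p] [PerfectField k] [Field K] [Algebra k K]
    (O : ValuationSubring K) (A₀ : Subalgebra k K) (h₀ : A₀.toSubring ≤ O.toSubring) (t : K),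
    CoreDatum p 4 k K O A₀ h₀ t → ¬ HasProperCoarsening O →
    ∀ (R : ℕ → Subring K) (P : (i : ℕ) → Ideal (R i)) (s : ℕ → K),
      R 0 = locAtCentre A₀.toSubring O → NormalAt O (R 0) p t → IsSteeredRun O R P t p s →
      (∃ i₀ : ℕ, ∀ i, i₀ ≤ i → ¬ IsHighOrderAt R s p i) →
      ∃ (L : Type) (_ : Field L) (_ : Algebra k L) (Y : ℕ → Subalgebra k L),
        Algebra.trdeg k L = 2 ∧
        (∀ n, IsLocalRing ↥(Y n) ∧ Algebra.EssFiniteType k ↥(Y n) ∧ IsFractionRing ↥(Y n) L) ∧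
        IsTamedMixedBranch (fun n => (Y n).toSubring) ∧ ∀ n, ¬ IsRegularLocalRing ↥(Y n)

/-- **NoEternalTamedMixedBranch** (M; res-type-026's k-FRAME ASK 08:36:37Z VERBATIM, RULING 21b(i); 026's target
`TamedMixedBranchReduction : Lipman1978ValuativeQuadraticSequence.{0} → NoEternalTamedMixedBranch`): a tamed mixed branch of local
`k`-subalgebras of `K` (transcendence degree 2), essentially of finite type with fraction field `K`, has a REGULAR member. Reduction (026):
Chevalley `O′ ⊇ ⋃ Y_n` dominating every member (p512861; partial normalisations are dominated), `k ⊆ Y_0 ⊆ O′`, re-index the point stages after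
the taming index, `x` = the chart parameter (maximal `O′`-value automatically), adjoin-shape = «local and dominated», `IsIntegrallyClosed` at the
re-start = clause (3), and «next point stage = localisation at the centre of `O′` of the integral closure of `Y[𝔪/x]`» from clauses (1)+(3).
Excellence needs no binder (essentially of finite type over a field; pv-012 q3). Why it might fail: the adjoin-shape / `EssFiniteType` bookkeeping
of the valuative fact's recursion clause. OURS. (ref. Lipman1978, Thm. p. 151, (1.32)–(1.33) p. 174) -/
def NoEternalTamedMixedBranch : Prop :=
  ∀ (k K : Type) [Field k] [Field K] [Algebra k K] (Y : ℕ → Subalgebra k K),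
    Algebra.trdeg k K = 2 → (∀ n, IsLocalRing ↥(Y n) ∧ Algebra.EssFiniteType k ↥(Y n) ∧ IsFractionRing ↥(Y n) K) →
    IsTamedMixedBranch (fun n => (Y n).toSubring) → ∃ n, IsRegularLocalRing ↥(Y n)

/-- **LOW KERNEL** (PROVED): `LowOrderTailConclTwoN` ⇐ pv-028's one-step lemma (`step`, §σ2.19: low infinitely often ⇒ eventually low) + D3 +
`NoEternalTamedMixedBranch`: the tamed branch of an eventually-LOW eternal run has a regular member (Lipman), but all its members are singular.
The no-dominant-tail hypothesis is discarded. Pure logic. OURS. [folklore] -/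
theorem lowOrderTailConclTwoN_of_tamedBranch
    (step : ∀ p : ℕ, p = 2 →
      ∀ (k K : Type) [Field k] [CharP k p] [PerfectField k] [Field K] [Algebra k K]
      (O : ValuationSubring K) (A₀ : Subalgebra k K) (h₀ : A₀.toSubring ≤ O.toSubring) (t : K),
      CoreDatum p 4 k K O A₀ h₀ t →
      ∀ (R : ℕ → Subring K) (P : (i : ℕ) → Ideal (R i)) (s : ℕ → K),
        R 0 = locAtCentre A₀.toSubring O → IsSteeredRun O R P t p s →
        ∀ i, ¬ IsHighOrderAt R s p i → ¬ IsHighOrderAt R s p (i + 1))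
    (hD3 : LowRunTamedMixedBranchTwo) (hNE : NoEternalTamedMixedBranch) : LowOrderTailConclTwoN := by
  intro p hp k K _ _ _ _ _ O A₀ h₀ t hcore hrk R P s hR0 hN hrun _hnd hio
  obtain ⟨L, _instF, _instA, Y, htr, hmem, htame, hsing⟩ :=
    hD3 p hp k K O A₀ h₀ t hcore hrk R P s hR0 hN hrun
      (lowOrder_eventually_of_io R s p (step p hp k K O A₀ h₀ t hcore R P s hR0 hrun) hio)
  obtain ⟨n, hn⟩ := hNE k L Y htr hmem htame
  exact (hsing n hn).elim

/-- **LOW CLOSES MODULO LIPMAN — in r27's `hLow`-slot shape** (PROVED glue; RULING 18b (B) / 21b(v)): with 026's reduction, the in-tree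
valuative fact `Lipman1978ValuativeQuadraticSequence` (PROVED from `Lipman1978SequenceFinite`, `…Proofs.of_sequenceFinite`) yields
`LowOrderTailConclTwoN`. HOLDER: `hLow ↦ lowOrderTailConclTwoN_of_lipman step hD3 hRed` in `eternalSteeredRunTwo_of_slate` (instance below).
Pure logic. OURS. [folklore] -/
theorem lowOrderTailConclTwoN_of_lipman
    (step : ∀ p : ℕ, p = 2 →
      ∀ (k K : Type) [Field k] [CharP k p] [PerfectField k] [Field K] [Algebra k K]
      (O : ValuationSubring K) (A₀ : Subalgebra k K) (h₀ : A₀.toSubring ≤ O.toSubring) (t : K),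
      CoreDatum p 4 k K O A₀ h₀ t →
      ∀ (R : ℕ → Subring K) (P : (i : ℕ) → Ideal (R i)) (s : ℕ → K),
        R 0 = locAtCentre A₀.toSubring O → IsSteeredRun O R P t p s →
        ∀ i, ¬ IsHighOrderAt R s p i → ¬ IsHighOrderAt R s p (i + 1))
    (hD3 : LowRunTamedMixedBranchTwo)
    (hRed : Literature.AlgebraicGeometry.Resolution.Lipman1978ValuativeQuadraticSequence.{0} → NoEternalTamedMixedBranch) :
    Literature.AlgebraicGeometry.Resolution.Lipman1978ValuativeQuadraticSequence.{0} → LowOrderTailConclTwoN :=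
  fun hLV => lowOrderTailConclTwoN_of_tamedBranch step hD3 (hRed hLV)

/-- Θ2 holds (res-type-071's kernel; `Perm := IsPermissibleCentre`, primality from `IsTopSingComponent`, non-maximality its first
field; `d = 3` from `CoreDatum`'s `trdeg_k K = 4`; only `A₀.FG`, `t ^ p ∈ A₀`, `Frac (k[A₀, t]) = K`, `trdeg_k K = 4` and the run
clause of `IsSteeredRun` are consumed). OURS. [folklore] -/
theorem hitHeightLtTwoN_holds : HitHeightLtTwoN := by
  intro p hp2 k K _i1 _i2 _i3 _i4 _i5 O A₀ h₀ t core _ R P s hR0 _ hrun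
  obtain ⟨hfg, htp, hfr, -, -, -, -, -, -, -, -, -, htr, -⟩ := core
  exact _root_.Summit.ResolutionOfSingularities.ResolutionOfSingularities.Theorems.SwitchingDichotomy.HitHeight.hitHeight_of_steeredRun
    (fun S hS f Q => @IsPermissibleCentre K _ S hS p f Q) p (fun S hS f Q h => ⟨h.2.1.elim fun hQ _ => hQ, h.1⟩)
    O A₀ h₀ hfg (by omega) htp hfr (d := 3) htr R P s hR0 hrun.2

/-- **`MembersDualDerivationsTwoN` holds** (adoption leaf over res-D-pv-007 AS stub-5's `MemberDualDerivations.hasDualDerivations_member`: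
every member is the local ring of a finitely generated model at the CLOSED centre of `O` (`exists_model_of_tower`), of dimension 4 (K-T1),
regular (M `steeredMembersRegular_holds`), hence carries a regular system of parameters with dual derivations
(`PfaffLine.exists_dual_derivations_locAtCentre`)). OURS. [folklore] -/
theorem membersDualDerivationsTwoN_holds : MembersDualDerivationsTwoN := by
  intro p hp k K _i1 _i2 _i3 _i4 _i5 O A₀ h₀ t core R P s hR0 hrun j
  subst hp
  haveI : Fact (Nat.Prime 2) := ⟨Nat.prime_two⟩
  have hreg : IsRegularLocalRing (R j) :=
    steeredMembersRegular_holds 2 Nat.prime_two 4 le_rfl k K O A₀ h₀ t core R P s j hR0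
      ⟨hrun.1, fun i _ => by obtain ⟨_, hs, -⟩ := hrun.2 i; exact hs, fun i _ => hrun.2 i⟩
  obtain ⟨hfg, htp, hfr, -, -, hzd, -, -, -, -, -, -, htr, -⟩ := core
  exact _root_.Summit.ResolutionOfSingularities.ResolutionOfSingularities.Theorems.SwitchingDichotomy.MemberDualDerivations.hasDualDerivations_member
    2 O A₀ h₀ t hfg htp hfr hzd (by exact_mod_cast htr) R hR0 j
    (fun i _ => by obtain ⟨_, _, -, hbl, -⟩ := hrun.2 i; exact hbl.isLocalBlowup) hreg


end SteeredTwo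

end Summit.ResolutionOfSingularities.ResolutionOfSingularities.Theorems.SwitchingDichotomy.Words
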